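import Summits.CriticalPhenomena.SAWScalingLimit.Theses.SAWLeftRightFKG
import Summits.CriticalPhenomena.SAWScalingLimit.Theorems.SAWLeftRightFKGLeftRightFKGReduction
import Summits.CriticalPhenomena.SAWScalingLimit.Theorems.SAWLeftRightFKGLeftRightFKGTP2Defs
import Summits.CriticalPhenomena.SAWScalingLimit.Theorems.SAWLeftRightFKGLeftRightFKGStubClassDictionary
import Summits.CriticalPhenomena.SAWScalingLimit.Theorems.SAWLeftRightFKGLeftRightFKGStubAllMeetProportional
import Summits.CriticalPhenomena.SAWScalingLimit.Theorems.SAWLeftRightFKGLeftRightFKGStubCornerAssembly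
import Summits.CriticalPhenomena.SAWScalingLimit.Theorems.SAWTotalPositivityBoundaryTP2Defs
import Summits.CriticalPhenomena.SAWScalingLimit.Theorems.SAWTotalPositivityBoundaryTP2Continuity
import Summits.CriticalPhenomena.SAWScalingLimit.Theorems.SAWLeftRightFKGLeftRightFKGStubVisitDeg2
import Summits.CriticalPhenomena.SAWScalingLimit.Theorems.SAWLeftRightFKGLeftRightFKGStubSquareLeOne
import Summits.CriticalPhenomena.SAWScalingLimit.Theorems.SAWLeftRightFKGLeftRightFKGStubChainGadget
import Summits.CriticalPhenomena.SAWScalingLimit.Theorems.SAWLeftRightFKGLeftRightFKGStubTwoChainThreePoint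
import Summits.CriticalPhenomena.SAWScalingLimit.Theorems.SAWLeftRightFKGLeftRightFKGStubBlobGadget
import Summits.CriticalPhenomena.SAWScalingLimit.Theorems.SAWLeftRightFKGLeftRightFKGStubCornerQuadrupleOfGraphTP2
import HarnessLib

/-!
# `LeftRightFKG ⟸ GraphTP2At x_c`: the crux is a corollary of the sibling core — crux `LeftRightFKG`
(stmt-CriticalPhenomena-11232), route SAWLeftRightFKG, line `corner-localisation`, lead c3 (skeleton v8)

After leads 0/c1/c2, the crux `Summit.CriticalPhenomena.SAWScalingLimit.Theses.SAWLeftRightFKG.LeftRightFKG`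
(left–right positive association of the critical square-lattice SAW chord measure) was a kernel-checked consequence of
`BoundaryTP2.InterlacedTP2At x_c ↔ GraphTP2At x_c ∧ ThreePointAt x_c`: the core of the SIBLING crux
`SAWTotalPositivity.BoundaryTP2` (stmt-CriticalPhenomena-7115) plus a second new conjecture (three-point splitting at
every vertex with one isolated lattice neighbour). Lead c3 removes the second conjecture: the corner assembly
(`CornerAssembly.corner_of_parts`, c1) consumes only `CornerQuadrupleTP2At x`, and every three-point / unit-bound
instance it needs sits at a vertex with TWO escape routes into the complement — the isolated marked points `p ∼ u, u'`
and `q ∼ w, w'` of the corner quadruple — where it follows from `GraphTP2At x` ALONE by finite gadgets evaluated exactly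
with the sibling's first-step toolkit (registered stubs of the line, all landed: `stub_visitDeg2` — paths through a
degree-2 vertex; `stub_chainGadget` — hang `c–p–b`, quadruple `(b,a,c,p)`; `stub_twoChainThreePoint`;
`stub_blobGadget` — hang `u–p–u'` across a one-vertex cut, quadruple `(u,w,z,p)`; `stub_squareLeOne` — hang the
4-cycle `u p u' q`, quadruple `(u,p,u',q)`; `stub_cornerQuadrupleOfGraphTP2` — c1's coincidences and c2's Menger
decomposition with gadget brackets). This file composes them:

* `cornerQuadrupleTP2At_of_graphTP2At : 0 < x → x < 1 → GraphTP2At x → CornerQuadrupleTP2At x`;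
* `corner_of_graphTP2At : 0 < x → x < 1 → GraphTP2At x → Corner x` (c1's `corner_of_parts` with the landed
  `stub_classDictionary`, `stub_allMeetProportional`);
* **`leftRightFKG_of_graphTP2At : GraphTP2At SAW.criticalFugacity → LeftRightFKG`** (lead 0's `stub_reduction`);
* `leftRightFKG_of_subcritical_graphTP2At : (∀ x, 0 < x → x < x_c → GraphTP2At x) → LeftRightFKG` (the sibling's
  landed continuity `graphTP2At_criticalFugacity_of_subcritical`).

So the two rank-2 cruxes of routes SAWLeftRightFKG and SAWTotalPositivity now share ONE core, `GraphTP2At x_c`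
(boundary TP₂ of the critical self-avoiding path kernel on finite subgraphs of `ℤ²`; a new conjecture, numerically true
on ≈ 1.2e9 instances, false at every `x_c < x < 1` by `BoundaryTP2.not_graphTP2At_of_criticalFugacity_lt`).
Everything here is proved; no `sorry`, no hypothesis beyond the displayed ones. [folklore]
-/

noncomputable section

open Literature.Probability.LatticeModels Literature.Probability.RandomPlanarGeometry
open Summit.CriticalPhenomena.SAWScalingLimit.Theorems.BoundaryTP2 (GraphTP2At graphTP2At_criticalFugacity_of_subcritical)
open Summit.CriticalPhenomena.SAWScalingLimit.Theorems.LeftRightFKG.CornerGadget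

namespace Summit.CriticalPhenomena.SAWScalingLimit.Theorems.LeftRightFKG.CornerLoc

/-- **Corner quadruples from the core** at every `0 < x < 1`: the line's six closed gadget stubs composed
(`stub_cornerQuadrupleOfGraphTP2` fed by `stub_chainGadget`, `stub_twoChainThreePoint`, `stub_blobGadget`,
`stub_squareLeOne`, all over `stub_visitDeg2`). [folklore] -/
theorem cornerQuadrupleTP2At_of_graphTP2At {x : ℝ} (hx0 : 0 < x) (hx1 : x < 1) (h : GraphTP2At x) :
    CornerQuadrupleTP2At x :=
  stub_cornerQuadrupleOfGraphTP2 x hx0 hx1 h (stub_chainGadget x hx0 hx1 h stub_visitDeg2)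
    (stub_twoChainThreePoint x hx0.le (stub_chainGadget x hx0 hx1 h stub_visitDeg2))
    (stub_blobGadget x hx0 hx1 h stub_visitDeg2) (stub_squareLeOne x hx0 hx1 h stub_visitDeg2)

/-- **Corner positivity from the core** at every `0 < x < 1`: c1's landed assembly `CornerAssembly.corner_of_parts`
with the landed `stub_classDictionary`, `stub_allMeetProportional` and `cornerQuadrupleTP2At_of_graphTP2At`.
[folklore] -/
theorem corner_of_graphTP2At {x : ℝ} (hx0 : 0 < x) (hx1 : x < 1) (h : GraphTP2At x) : Corner x :=
  CornerAssembly.corner_of_parts hx0 stub_classDictionary (stub_allMeetProportional x hx0)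
    (cornerQuadrupleTP2At_of_graphTP2At hx0 hx1 h)

/-- **The crux `LeftRightFKG` is a corollary of the sibling core `GraphTP2At x_c`** (the registered open stub
`stub_graphTP2` of both cruxes stmt-CriticalPhenomena-11232 and stmt-CriticalPhenomena-7115): corner positivity at
`x_c` (`corner_of_graphTP2At`, `CornerCritical = Corner x_c`) and lead 0's landed Transfer `stub_reduction`.
[folklore] -/
theorem leftRightFKG_of_graphTP2At (h : GraphTP2At SAW.criticalFugacity) :
    Summit.CriticalPhenomena.SAWScalingLimit.Theses.SAWLeftRightFKG.LeftRightFKG :=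
  stub_reduction (corner_of_graphTP2At SAW.criticalFugacity_pos_lt_one'.1 SAW.criticalFugacity_pos_lt_one'.2 h)

/-- The crux from the core at all SUBCRITICAL fugacities (the sibling's landed continuity
`BoundaryTP2.graphTP2At_criticalFugacity_of_subcritical` closes the admissible set from below at `x_c`). [folklore] -/
theorem leftRightFKG_of_subcritical_graphTP2At (h : ∀ x : ℝ, 0 < x → x < SAW.criticalFugacity → GraphTP2At x) :
    Summit.CriticalPhenomena.SAWScalingLimit.Theses.SAWLeftRightFKG.LeftRightFKG :=
  leftRightFKG_of_graphTP2At (graphTP2At_criticalFugacity_of_subcritical h)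

end Summit.CriticalPhenomena.SAWScalingLimit.Theorems.LeftRightFKG.CornerLoc

end
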